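import Literature.AlgebraicGeometry.Resolution.MarkedIdeals
import Literature.AlgebraicGeometry.Resolution.Blowups
import Literature.AlgebraicGeometry.Resolution.BlowupsProperProofs
import Literature.AlgebraicGeometry.Resolution.BlowupsProduct
import Literature.AlgebraicGeometry.Resolution.BlowupSNC
import Literature.AlgebraicGeometry.Resolution.StrictTransformBaseChange
import Literature.AlgebraicGeometry.Resolution.HypersurfaceRestriction
import Literature.AlgebraicGeometry.Resolution.BlowupChartMembership
import Literature.AlgebraicGeometry.Resolution.ColonIdealSheafFG
import Literature.AlgebraicGeometry.Resolution.AlterationsSectionDivisor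
import Literature.AlgebraicGeometry.Resolution.StalkIdealGenerization
import Literature.AlgebraicGeometry.Resolution.QuasiExcellentCurveDelta
import Literature.RingTheory.DiscreteValuationRing.DeligneSerreLiftingProofs
import Literature.AlgebraicGeometry.Resolution.EffectiveCartierStalks
import Literature.AlgebraicGeometry.Resolution.PermissibleCentres
import Mathlib.AlgebraicGeometry.IdealSheaf.Functorial
import Mathlib.AlgebraicGeometry.Morphisms.ClosedImmersion
import Mathlib.AlgebraicGeometry.FunctionField
import Mathlib.RingTheory.Length
import Mathlib.RingTheory.RegularLocalRing.Defs
import HarnessLib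

/-!
# The intersection multiplicity `m_p(Y ∩ Z)` of Stacks Tag 0BI3 is a positive integer (PROVED)

Topic: `Literature/AlgebraicGeometry/Resolution`. Companion of the named fact
`Stacks0BI7_intersectionMultiplicityDrop` (`PointBlowupIntersectionMultiplicity.lean`, The Stacks Project
Lemma 54.15.3 = Tag 0BI7). The Stacks Project, §54.15, running text before Lemma 54.15.3 (Tag 0BI3), in the
situation «`X` locally Noetherian; `Y, Z ⊂ X` closed subschemes; `p ∈ Y ∩ Z` a closed point; `Y` integral of
dimension `1`; the generic point of `Y` not contained in `Z`», says about
`m_p(Y ∩ Z) = length_{𝒪_{X,p}}(𝒪_{Y∩Z,p})` ((54.15.2.1), Tag 0BI6):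

  «This is an integer `≥ 1`. Namely, if `I, J ⊂ 𝒪_{X,p}` are the ideals corresponding to `Y, Z`, then we
  see that `𝒪_{Y∩Z,p} = 𝒪_{X,p}/I + J` has support equal to `{𝔪_p}` because we assumed that `Y ∩ Z` does
  not contain the unique point of `Y` specializing to `p`. Hence the length is finite by Algebra,
  Lemma 10.62.3.»

This file PROVES that sentence in the binders of the named fact (curve `Y` presented by a closed immersion
`i : Y ⟶ X`, `Y` integral with `topologicalKrullDim Y = 1`, `𝒪_{Y,y}` regular at the point `y` over `p`,
`Z = V(J)` with `p ∈ V(J)` and `i(η_Y) ∉ V(J)`; multiplicity = `Module.length` of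
`𝒪_{X,p} ⧸ (stalkIdeal i.ker p ⊔ stalkIdeal J p)` in `ℕ∞`), so that consumers may read the multiplicity in
`ℕ` (`ENat.toNat`) without loss:

* `one_le_length_stalk_quotient_ker_sup` — `1 ≤ m_p(Y ∩ Z)` (both stalk ideals lie in `𝔪_p`; no
  regularity or dimension hypothesis needed);
* `length_stalk_quotient_ker_sup_ne_top` — `m_p(Y ∩ Z) ≠ ⊤`: along the surjection
  `𝒪_{X,p} → 𝒪_{Y,y}` with kernel `(i.ker)_p` (`stalkIdeal_ker_eq_ker_stalkMap`) the module is
  `𝒪_{Y,y} ⧸ J𝒪_{Y,y}`, `𝒪_{Y,y}` is a regular local domain of dimension `≤ 1`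
  (`ringKrullDim_stalk_le_one`), hence a principal ideal ring, and `J𝒪_{Y,y} ≠ 0` because otherwise
  `J_p ⊆ (i.ker)_p ⊆ 𝔭_{i(η_Y)}`, i.e. `i(η_Y) ∈ V(J)` (`mem_support_iff_stalkIdeal_le_primeOfSpecializes`);
  a one-dimensional Noetherian domain modulo a non-zero element has finite length
  (`length_quot_span_singleton_ne_top`);
* `isEffectiveCartier_comap_vanishingIdeal_singleton` — the FIRST STEP of the printed proof of Lemma 54.15.3
  (Tag 0BI7: «we can pick an element `x₁ ∈ 𝔪_p` mapping to a uniformizer in `𝒪_{Y,p}` … We conclude that `p` is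
  an effective Cartier divisor on `Y`»): the pulled-back ideal `i^*𝓘_{p}` of the closed point `p = i y` is an
  effective Cartier divisor on `Y` (tree `IsEffectiveCartier`) when `𝒪_{Y,y}` is regular of dimension `≤ 1` and
  not a field — with `maximalIdeal_stalk_ne_bot` supplying «not a field» from the binders of the fact (a private
  helper records that a surjective local homomorphism maps `𝔪` onto `𝔪`). These are the entry of a
  future discharge of the fact (`IsBlowup.isIso`: blowing up an effective Cartier divisor is an isomorphism,
  clause (1) of 54.15.3).

Revision 3 then PROVES THE WHOLE LEMMA (sections `StrictTransform`, `Lengths`, `PointAbove`):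
`Stacks0BI7_intersectionMultiplicityDrop_proof` is the statement of the named fact verbatim, as a theorem —
clause (1) chart-free through the universal property (`isBlowup_lift_subschemeι_strictTransformIdeal`: the strict
transform of a closed subscheme is its blow-up in the restricted centre, Stacks Tag 080E, because the exceptional
divisor stays effective Cartier on the `𝓘(E)`-saturated strict transform; then `IsBlowup.isIso`), clauses (2)–(3)
by transporting the lengths to `𝒪_{Y,p}` along the stalk surjections and the isomorphism of (1) and a Nakayama
step (`length_quotient_lt_of_le_maximalIdeal_mul`). The discharge `Stacks0BI7_intersectionMultiplicityDrop_holds`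
is the one-line corollary appended to `PointBlowupIntersectionMultiplicity.lean` (which imports this file; this
file therefore no longer imports it).

No new definitions, no new named facts; kernel-checked assembly of tree lemmas. AI-written; weaker than
expert review. Not a statement of H. Hironaka's 2017 manuscript.

## References

* The Stacks Project, Tag 0BI3 (§54.15, the situation before Lemma 54.15.3), Tag 0BI6 ((54.15.2.1)),
  Tag 00L5 (= Algebra, Lemma 10.62.3, cited there), Tag 00IX (Algebra, Lemma 10.52.5: length along a
  surjective ring map), Tag 00IY (Algebra, Lemma 10.52.6), Tag 00DV (Algebra, Lemma 10.20.1, Nakayama),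
  Tag 0BI7 (Lemma 54.15.3) with the two lemmas its proof cites: Tag 080E (Divisors, Lemma 31.34.2 — the
  strict transform is the blowing up in the pulled-back centre; Definition 31.34.1 = Tag 080D) and Tag 0807
  (Divisors, Lemma 31.33.7 — the blowup of a scheme in an effective Cartier divisor is the identity); tags read
  by GET 2026-08-27 (lemma numbers are those displayed on that date). [StacksProject]
* U. Görtz, T. Wedhorn, Algebraic Geometry I, 2nd ed. (2020), Def. 13.90, (13.19)–(13.20) p. 413–414. [GortzWedhorn2020]
-/

noncomputable section

open CategoryTheory AlgebraicGeometry TopologicalSpace IsLocalRing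

namespace Literature.AlgebraicGeometry.Resolution

universe u

open Scheme.IdealSheafData

section

variable {X Y : Scheme.{u}} (i : Y ⟶ X) [IsClosedImmersion i] (J : X.IdealSheafData) (y : Y)

omit [IsClosedImmersion i] in
/-- **`m_p(Y ∩ Z) ≥ 1`** (Stacks Tag 0BI3: «This is an integer `≥ 1`»): for a closed immersion
`i : Y ⟶ X`, a point `y` of `Y` and an ideal sheaf `J` with `i y ∈ V(J)`, the `𝒪_{X,i y}`-module
`𝒪_{X,i y} ⧸ ((i.ker)_{i y} + J_{i y})` is non-zero, so its length is at least `1`.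
[cite: StacksProject, Tag 0BI3 (§54.15, before Lemma 54.15.3)] -/
theorem one_le_length_stalk_quotient_ker_sup (hpZ : i y ∈ J.support) :
    1 ≤ Module.length (X.presheaf.stalk (i y))
      (X.presheaf.stalk (i y) ⧸ (stalkIdeal i.ker (i y) ⊔ stalkIdeal J (i y))) := by
  have hI : stalkIdeal i.ker (i y) ≤ maximalIdeal (X.presheaf.stalk (i y)) :=
    (mem_support_iff_stalkIdeal_le _ _).mp (i.range_subset_ker_support ⟨y, rfl⟩)
  have hJ : stalkIdeal J (i y) ≤ maximalIdeal (X.presheaf.stalk (i y)) :=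
    (mem_support_iff_stalkIdeal_le _ _).mp hpZ
  have hne : stalkIdeal i.ker (i y) ⊔ stalkIdeal J (i y) ≠ ⊤ :=
    fun h => (maximalIdeal.isMaximal (X.presheaf.stalk (i y))).ne_top (top_le_iff.mp (h ▸ sup_le hI hJ))
  haveI : Nontrivial (X.presheaf.stalk (i y) ⧸ (stalkIdeal i.ker (i y) ⊔ stalkIdeal J (i y))) :=
    Ideal.Quotient.nontrivial_iff.mpr hne
  exact Order.one_le_iff_ne_zero.mpr Module.length_pos.ne'

/-- The image of `J_{i y}` in `𝒪_{Y,y}` is non-zero when the generic point of the integral curve `Y` does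
not lie on `V(J)` (Stacks Tag 0BI3: «because we assumed that `Y ∩ Z` does not contain the unique point of `Y`
specializing to `p`»). [cite: StacksProject, Tag 0BI3 (§54.15, before Lemma 54.15.3)] -/
theorem map_stalkMap_stalkIdeal_ne_bot [IsIntegral Y] (hη : i (genericPoint Y) ∉ J.support) :
    (stalkIdeal J (i y)).map (i.stalkMap y).hom ≠ ⊥ := by
  intro h
  apply hη
  -- `J_{i y} ⊆ ker (𝒪_{X,i y} → 𝒪_{Y,y}) = (i.ker)_{i y}`
  have hle : stalkIdeal J (i y) ≤ stalkIdeal i.ker (i y) := by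
    rw [stalkIdeal_ker_eq_ker_stalkMap i y]
    intro f hf
    rw [RingHom.mem_ker]
    have : (i.stalkMap y).hom f ∈ (stalkIdeal J (i y)).map (i.stalkMap y).hom :=
      Ideal.mem_map_of_mem _ hf
    rwa [h, Ideal.mem_bot] at this
  -- along `i η ⤳ i y`: `i η ∈ V(i.ker)` gives `(i.ker)_{i y} ≤ 𝔭_{i η}`, hence `J_{i y} ≤ 𝔭_{i η}`
  have hsp : i (genericPoint Y) ⤳ i y := (genericPoint_specializes y).map i.continuous
  have hker : i (genericPoint Y) ∈ i.ker.support := i.range_subset_ker_support ⟨_, rfl⟩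
  rw [mem_support_iff_stalkIdeal_le_primeOfSpecializes hsp] at hker ⊢
  exact hle.trans hker

/-- **`m_p(Y ∩ Z)` is finite** (Stacks Tag 0BI3: «Hence the length is finite by Algebra, Lemma 10.62.3»),
in the binders of `Stacks0BI7_intersectionMultiplicityDrop`: `Y` integral of dimension `1` with `𝒪_{Y,y}`
regular, `i(η_Y) ∉ V(J)`. Proof: `𝒪_{X,i y} ⧸ ((i.ker)_{i y} + J_{i y}) ≅ 𝒪_{Y,y} ⧸ J𝒪_{Y,y}` along the
surjection `𝒪_{X,i y} → 𝒪_{Y,y}`, `𝒪_{Y,y}` is a regular local domain of dimension `≤ 1` (a principal ideal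
ring), and `J𝒪_{Y,y}` contains a non-zero element. [cite: StacksProject, Tag 0BI3 (§54.15, before Lemma 54.15.3)] -/
theorem length_stalk_quotient_ker_sup_ne_top [IsIntegral Y] (hdim : topologicalKrullDim Y = 1)
    (hreg : IsRegularLocalRing (Y.presheaf.stalk y)) (hη : i (genericPoint Y) ∉ J.support) :
    Module.length (X.presheaf.stalk (i y))
      (X.presheaf.stalk (i y) ⧸ (stalkIdeal i.ker (i y) ⊔ stalkIdeal J (i y))) ≠ ⊤ := by
  set R := X.presheaf.stalk (i y) with hR
  set A := Y.presheaf.stalk y with hA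
  let φ : R →+* A := (i.stalkMap y).hom
  have hφ : Function.Surjective φ := i.stalkMap_surjective y
  set Jb : Ideal A := (stalkIdeal J (i y)).map φ with hJb
  -- the composite surjection `ψ : R → A ⧸ Jb` and its kernel
  let ψ : R →+* A ⧸ Jb := (Ideal.Quotient.mk Jb).comp φ
  have hψ : Function.Surjective ψ := Ideal.Quotient.mk_surjective.comp hφ
  have hkerψ : RingHom.ker ψ = stalkIdeal i.ker (i y) ⊔ stalkIdeal J (i y) := by
    rw [← RingHom.comap_ker, Ideal.mk_ker, hJb, Ideal.comap_map_of_surjective φ hφ,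
      ← RingHom.ker_eq_comap_bot, stalkIdeal_ker_eq_ker_stalkMap i y, sup_comm]
  -- `A ⧸ Jb` as an `R`-algebra through `ψ`
  letI : Algebra R (A ⧸ Jb) := ψ.toAlgebra
  have halg : algebraMap R (A ⧸ Jb) = ψ := rfl
  -- `R ⧸ (I + J) ≃ₗ[R] A ⧸ Jb`
  have hkerlin : LinearMap.ker (Algebra.linearMap R (A ⧸ Jb)) =
      stalkIdeal i.ker (i y) ⊔ stalkIdeal J (i y) := by
    ext r
    rw [LinearMap.mem_ker, Algebra.linearMap_apply, halg, ← hkerψ, RingHom.mem_ker]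
  have hsurj : Function.Surjective (Algebra.linearMap R (A ⧸ Jb)) := by
    intro b; obtain ⟨r, hr⟩ := hψ b; exact ⟨r, by rw [Algebra.linearMap_apply, halg, hr]⟩
  let e : (R ⧸ (stalkIdeal i.ker (i y) ⊔ stalkIdeal J (i y))) ≃ₗ[R] (A ⧸ Jb) :=
    (Submodule.quotEquivOfEq _ _ (by rw [← hkerlin])).trans
      ((Algebra.linearMap R (A ⧸ Jb)).quotKerEquivOfSurjective hsurj)
  rw [e.length_eq, Module.length_eq_of_surjective (S := R) (R := A ⧸ Jb) (M := A ⧸ Jb) (halg ▸ hψ),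
    ← Module.length_eq_of_surjective (S := A) (R := A ⧸ Jb) (M := A ⧸ Jb) Ideal.Quotient.mk_surjective]
  -- `A` is a one-dimensional Noetherian domain (regular local of dimension `≤ 1` ⇒ principal ideal ring)
  haveI : IsRegularLocalRing A := hreg
  have hdimA : ringKrullDim A ≤ 1 := ringKrullDim_stalk_le_one hdim.le y
  haveI : IsPrincipalIdealRing A := isPrincipalIdealRing_of_ringKrullDim_le_one hdimA
  haveI : Ring.DimensionLEOne A := inferInstance
  -- a non-zero element of `Jb`
  have hJb0 : Jb ≠ ⊥ := map_stalkMap_stalkIdeal_ne_bot i J y hη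
  obtain ⟨a, haJ, ha0⟩ := Submodule.exists_mem_ne_zero_of_ne_bot hJb0
  have hfin := Literature.RingTheory.DiscreteValuationRing.KrullAkizuki.length_quot_span_singleton_ne_top
    (A := A) ha0
  -- `A ⧸ (a) ↠ A ⧸ Jb`
  have hle : Module.length A (A ⧸ Jb) ≤ Module.length A (A ⧸ Ideal.span {a}) :=
    Module.length_le_of_surjective
      (Submodule.mapQ (Ideal.span {a}) Jb LinearMap.id
        (by simpa [Submodule.comap_id] using (Ideal.span_singleton_le_iff_mem _).mpr haJ))
      (by
        rintro ⟨b⟩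
        exact ⟨Submodule.Quotient.mk b, rfl⟩)
  exact fun htop => hfin (top_le_iff.mp (htop ▸ hle))

/-! ## First step of the printed proof of Lemma 54.15.3: the point is an effective Cartier divisor on the curve -/

omit [IsClosedImmersion i] in
/-- Along a surjective local homomorphism the maximal ideal maps ONTO the maximal ideal. [folklore] -/
private theorem map_stalkMap_maximalIdeal_eq (hφ : Function.Surjective (i.stalkMap y).hom) :
    (maximalIdeal (X.presheaf.stalk (i y))).map (i.stalkMap y).hom = maximalIdeal (Y.presheaf.stalk y) := by
  apply le_antisymm
  · exact Ideal.map_le_iff_le_comap.mpr fun r hr => map_nonunit (i.stalkMap y).hom r hr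
  · intro a ha
    obtain ⟨r, rfl⟩ := hφ a
    refine Ideal.mem_map_of_mem _ ?_
    by_contra hr
    have hu : IsUnit r := by
      by_contra hnu
      exact hr ((IsLocalRing.mem_maximalIdeal r).mpr hnu)
    exact (IsLocalRing.mem_maximalIdeal _).mp ha (hu.map (i.stalkMap y).hom)

/-- **The pulled-back point is an effective Cartier divisor on the curve** (Stacks Tag 0BI7, proof, first step:
«Since `𝒪_{X,p} → 𝒪_{Y,p}` is surjective and `𝒪_{Y,p}` is a discrete valuation ring, we can pick an element
`x₁ ∈ 𝔪_p` mapping to a uniformizer in `𝒪_{Y,p}` … We conclude that `p` is an effective Cartier divisor on `Y`»):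
for a closed immersion `i : Y ⟶ X` of an integral locally Noetherian `Y`, a closed point `p = i y` and `𝒪_{Y,y}`
regular of dimension `≤ 1` and not a field, the ideal sheaf `i^*𝓘_{p}` (`(vanishingIdeal {p}).comap i`) is an
effective Cartier divisor on `Y`: its support is `{y}` and its stalk there is `𝔪_y = (t)`, `t ≠ 0`.
[cite: StacksProject, Tag 0BI7 (Lemma 54.15.3, proof)] -/
theorem isEffectiveCartier_comap_vanishingIdeal_singleton [IsIntegral Y] [IsLocallyNoetherian Y]
    {p : X} (hp : IsClosed ({p} : Set X)) (hy : i y = p)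
    (hreg : IsRegularLocalRing (Y.presheaf.stalk y)) (hdimA : ringKrullDim (Y.presheaf.stalk y) ≤ 1)
    (hm : maximalIdeal (Y.presheaf.stalk y) ≠ ⊥) :
    IsEffectiveCartier ((vanishingIdeal ⟨{p}, hp⟩).comap i) := by
  subst hy
  refine isEffectiveCartier_of_forall_mem_nonZeroDivisors fun x hx => ?_
  -- the support of `i^*𝓘_{i y}` is `{y}`
  have h1 : (x : Y) ∈ ((((vanishingIdeal ⟨{i y}, hp⟩).comap i).support : Set Y)) := hx
  rw [support_comap, TopologicalSpace.Closeds.coe_preimage, coe_support_vanishingIdeal] at h1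
  have hxy : i x = i y := by simpa using h1
  obtain rfl : x = y := i.isClosedEmbedding.injective hxy
  -- the stalk at `y` is the image of `𝔪_{i y}`, i.e. `𝔪_y = (t)` with `t ≠ 0`
  haveI : IsRegularLocalRing (Y.presheaf.stalk x) := hreg
  haveI : IsPrincipalIdealRing (Y.presheaf.stalk x) := isPrincipalIdealRing_of_ringKrullDim_le_one hdimA
  obtain ⟨t, ht⟩ := (IsPrincipalIdealRing.principal (maximalIdeal (Y.presheaf.stalk x))).principal
  have ht0 : t ≠ 0 := by
    rintro rfl
    apply hm
    rw [ht]
    simp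
  refine ⟨t, mem_nonZeroDivisors_of_ne_zero ht0, ?_⟩
  rw [stalkIdeal_comap_eq_map_stalkMap, stalkIdeal_vanishingIdeal_singleton hp,
    map_stalkMap_maximalIdeal_eq i x (i.stalkMap_surjective x), ht]

/-- In the binders of `Stacks0BI7_intersectionMultiplicityDrop` the local ring `𝒪_{Y,y}` is not a field: the
non-zero ideal `J𝒪_{Y,y}` lies in `𝔪_y`. [cite: StacksProject, Tag 0BI3 (§54.15, before Lemma 54.15.3)] -/
theorem maximalIdeal_stalk_ne_bot [IsIntegral Y] (hpZ : i y ∈ J.support)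
    (hη : i (genericPoint Y) ∉ J.support) : maximalIdeal (Y.presheaf.stalk y) ≠ ⊥ := by
  intro h
  apply map_stalkMap_stalkIdeal_ne_bot i J y hη
  rw [eq_bot_iff, ← h]
  exact Ideal.map_le_iff_le_comap.mpr fun r hr =>
    map_nonunit (i.stalkMap y).hom r ((mem_support_iff_stalkIdeal_le _ _).mp hpZ hr)

end

/-! ## Clause (1) of Lemma 54.15.3: the strict transform of the curve is the curve

The Stacks Project proves clause (1) of Tag 0BI7 by «We conclude that `p` is an effective Cartier divisor
on `Y` and since `Y'` is the blowing up of `Y` in `p` (Divisors, Lemma 31.34.2) we see that `Y' → Y` is an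
isomorphism by Divisors, Lemma 31.33.7» (Tags 080E, 0807: the strict transform of a closed subscheme is its
blow-up in the pulled-back centre, and the blow-up in an effective Cartier divisor is the identity). We follow
this chart-free road: for ANY closed immersion `i : Y ⟶ X` and blow-up `π : X' ⟶ X` with centre `V(C)`,
the strict transform `V(σᶜ(i.ker)) ⟶ Y` (the lift of `V(σᶜ(i.ker)) ↪ X' → X` through `i`) is a
blow-up of `Y` along `i^*C` (`IsBlowup`, universal property), because the exceptional divisor restricts
to an effective Cartier divisor on the `𝓘(D)`-saturated closed subscheme `V(σᶜ(i.ker))`; when `i^*C` is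
already an effective Cartier divisor the lift is an isomorphism (`IsBlowup.isIso`). -/

section StrictTransform

variable {X X' : Scheme.{u}} [IsLocallyNoetherian X] {π : X' ⟶ X} {C : X.IdealSheafData}

/-- Saturation of `⋃ₙ (L : eⁿ)`: if `e · a ∈ ⋃ₙ (L : eⁿ)` then `a ∈ ⋃ₙ (L : eⁿ)`. [folklore] -/
private theorem mem_iSup_colon_span_pow_of_mul_mem {R : Type*} [CommRing R] (L : Ideal R)
    (e a : R) (h : e * a ∈ ⨆ n : ℕ, Submodule.colon L ((Ideal.span {e} ^ n : Ideal R) : Set R)) :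
    a ∈ ⨆ n : ℕ, Submodule.colon L ((Ideal.span {e} ^ n : Ideal R) : Set R) := by
  have hdir : Directed (· ≤ ·)
      (fun n : ℕ => Submodule.colon L ((Ideal.span {e} ^ n : Ideal R) : Set R)) :=
    Monotone.directed_le fun m n hmn =>
      Submodule.colon_mono le_rfl (SetLike.coe_subset_coe.mpr (Ideal.pow_le_pow_right hmn))
  obtain ⟨N, hN⟩ := (Submodule.mem_iSup_of_directed _ hdir).mp h
  refine (Submodule.mem_iSup_of_directed _ hdir).mpr ⟨N + 1, ?_⟩
  rw [Ideal.span_singleton_pow, Submodule.mem_colon] at hN ⊢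
  intro s hs
  obtain ⟨d, rfl⟩ := Ideal.mem_span_singleton'.mp hs
  have h1 := hN (d * e ^ N) (Ideal.mem_span_singleton'.mpr ⟨d, rfl⟩)
  rw [smul_eq_mul] at h1 ⊢
  have : a * (d * e ^ (N + 1)) = e * a * (d * e ^ N) := by ring
  rw [this]
  exact h1

/-- **The exceptional divisor restricts to an effective Cartier divisor on a strict transform**
(Görtz–Wedhorn I, (13.19): the strict transform `V(⋃ₙ (π^*K : 𝓘(D)ⁿ))` is `𝓘(D)`-saturated, so a local
equation of `D = π⁻¹(V(C))` stays a non-zero-divisor modulo the strict-transform ideal; Stacks Tag 080E).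
For `X` locally Noetherian, `π : X' ⟶ X` a blow-up with centre `V(C)` and any ideal sheaf `K` on `X`.
[cite: GortzWedhorn2020, (13.19) p. 414] -/
theorem isEffectiveCartier_comap_subschemeι_strictTransformIdeal (hπ : IsBlowup π C)
    (K : X.IdealSheafData) :
    IsEffectiveCartier ((C.comap π).comap (strictTransformIdeal π C K).subschemeι) := by
  haveI : IsProper π := hπ.isProper
  haveI : IsLocallyNoetherian X' := LocallyOfFiniteType.isLocallyNoetherian π
  haveI : IsLocallyNoetherian (strictTransformIdeal π C K).subscheme :=
    LocallyOfFiniteType.isLocallyNoetherian (strictTransformIdeal π C K).subschemeι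
  refine isEffectiveCartier_of_forall_mem_nonZeroDivisors fun v _ => ?_
  obtain ⟨e, -, hEe⟩ :=
    hπ.isEffectiveCartier.exists_stalkIdeal_eq_span ((strictTransformIdeal π C K).subschemeι v)
  have hsurj : Function.Surjective ((strictTransformIdeal π C K).subschemeι.stalkMap v).hom :=
    (strictTransformIdeal π C K).subschemeι.stalkMap_surjective v
  have hker : RingHom.ker ((strictTransformIdeal π C K).subschemeι.stalkMap v).hom =
      stalkIdeal (strictTransformIdeal π C K) ((strictTransformIdeal π C K).subschemeι v) := by
    rw [← stalkIdeal_ker_eq_ker_stalkMap, ker_subschemeι]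
  refine ⟨((strictTransformIdeal π C K).subschemeι.stalkMap v).hom e, ?_, ?_⟩
  · -- the image of the local equation `e` of `D` is a non-zero-divisor of `𝒪_{X',v} ⧸ σᶜ(K)_v`
    refine mem_nonZeroDivisors_iff_right.mpr fun b hb => ?_
    obtain ⟨a, rfl⟩ := hsurj b
    rw [← map_mul, ← RingHom.mem_ker, hker, stalkIdeal_strictTransformIdeal, hEe] at hb
    rw [← RingHom.mem_ker, hker, stalkIdeal_strictTransformIdeal, hEe]
    exact mem_iSup_colon_span_pow_of_mul_mem _ e a (by rw [mul_comm]; exact hb)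
  · rw [stalkIdeal_comap_eq_map_stalkMap, hEe, Ideal.map_span, Set.image_singleton]

omit [IsLocallyNoetherian X] in
/-- `i.ker ⊆ ker (V(σᶜ(i.ker)) ↪ X' → X)`: the strict transform of `Y = V(i.ker)` lies over `Y`
(`π^* i.ker ⊆ σᶜ(i.ker)`, the term `n = 0`; Stacks Definition 31.34.1: the strict transform is a closed
subscheme of the base change `Y ×_X X'`). [cite: StacksProject, Tag 080D (Definition 31.34.1)] -/
theorem ker_le_ker_subschemeι_strictTransformIdeal_comp (π : X' ⟶ X) (C : X.IdealSheafData)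
    {Y : Scheme.{u}} (i : Y ⟶ X) :
    i.ker ≤ ((strictTransformIdeal π C i.ker).subschemeι ≫ π).ker := by
  rw [Scheme.Hom.ker_comp, ker_subschemeι, le_map_iff_comap_le]
  exact comap_le_strictTransformIdeal π C i.ker

/-- **The strict transform of a closed subscheme is its blow-up in the restricted centre** (Stacks Tag
080E = Divisors, Lemma 31.34.2, for the closed immersion `Y ⟶ X`; Görtz–Wedhorn I, (13.19)–(13.20)): for a blow-up `π : X' ⟶ X` of the locally Noetherian `X` with
centre `V(C)` and a closed immersion `i : Y ⟶ X`, the morphism `V(σᶜ(i.ker)) ⟶ Y` lifting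
`V(σᶜ(i.ker)) ↪ X' → X` through `i` is a blow-up of `Y` along `i^*C` (tree `IsBlowup`: the exceptional
divisor restricts to an effective Cartier divisor, and a morphism `w : W ⟶ Y` with `w^*(i^*C)` effective
Cartier lifts uniquely — its lift to `X'` kills `σᶜ(i.ker) = ⋃ₙ (π^* i.ker : 𝓘(D)ⁿ)` because
`𝓘(D)ⁿ · (π^* i.ker : 𝓘(D)ⁿ) ⊆ π^* i.ker` pulls back to `0` on `W` and `w^*(i^*C)ⁿ` is a non-zero-divisor
ideal). [cite: StacksProject, Tag 080E (Divisors, Lemma 31.34.2)] -/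
theorem isBlowup_lift_subschemeι_strictTransformIdeal (hπ : IsBlowup π C) {Y : Scheme.{u}}
    (i : Y ⟶ X) [IsClosedImmersion i] :
    IsBlowup (IsClosedImmersion.lift i ((strictTransformIdeal π C i.ker).subschemeι ≫ π)
      (ker_le_ker_subschemeι_strictTransformIdeal_comp π C i)) (C.comap i) := by
  constructor
  · rw [← comap_comp, IsClosedImmersion.lift_fac, comap_comp]
    exact isEffectiveCartier_comap_subschemeι_strictTransformIdeal hπ i.ker
  · intro W w hw
    have hwi : IsEffectiveCartier (C.comap (w ≫ i)) := by rwa [comap_comp]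
    -- `π^*C` pulls back along the lift `g₀ : W ⟶ X'` of `w ≫ i` to `w^*(i^*C)`
    have hEg : (C.comap π).comap (hπ.lift (w ≫ i) hwi) = (C.comap i).comap w := by
      rw [← comap_comp, hπ.lift_comp, comap_comp]
    -- the strict-transform ideal dies on `W`
    have hle : (strictTransformIdeal π C i.ker).subschemeι.ker ≤ (hπ.lift (w ≫ i) hwi).ker := by
      rw [ker_subschemeι]
      refine iSup_le fun n => ?_
      rw [← map_bot (hπ.lift (w ≫ i) hwi), le_map_iff_comap_le, le_bot_iff]
      apply (hw.pow n).eq_bot_of_mul_eq_bot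
      rw [eq_bot_iff, ← hEg, ← comap_pow, ← comap_mul]
      refine (comap_mono _ (mul_colon_le _ _)).trans ?_
      show (i.ker.comap π).comap (hπ.lift (w ≫ i) hwi) ≤ ⊥
      rw [← comap_comp, hπ.lift_comp, comap_comp, comap_ker_self i]
      exact (map_gc w).l_bot.le
    refine ⟨IsClosedImmersion.lift (strictTransformIdeal π C i.ker).subschemeι
      (hπ.lift (w ≫ i) hwi) hle, ?_, ?_⟩
    · change IsClosedImmersion.lift _ _ hle ≫ IsClosedImmersion.lift i _ _ = w
      rw [← cancel_mono i, Category.assoc, IsClosedImmersion.lift_fac, ← Category.assoc,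
        IsClosedImmersion.lift_fac, hπ.lift_comp]
    · intro g' hg'
      change g' ≫ IsClosedImmersion.lift i _ _ = w at hg'
      rw [← cancel_mono (strictTransformIdeal π C i.ker).subschemeι, IsClosedImmersion.lift_fac]
      apply hπ.lift_unique
      rw [Category.assoc, ← IsClosedImmersion.lift_fac i ((strictTransformIdeal π C i.ker).subschemeι ≫ π)
        (ker_le_ker_subschemeι_strictTransformIdeal_comp π C i), ← Category.assoc, hg']

/-- **Blowing up a closed subscheme in an effective Cartier divisor does not change it**: if `i^*C` is
an effective Cartier divisor on `Y`, the strict transform `V(σᶜ(i.ker))` is isomorphic to `Y` over `X`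
(Stacks Tags 080E and 0807, as combined in the proof of Tag 0BI7: «we see that `Y' → Y` is an
isomorphism»; Görtz–Wedhorn I, remark after Def. 13.90). [cite: StacksProject, Tag 0BI7 (Lemma 54.15.3 (1), proof)] -/
theorem exists_iso_subscheme_strictTransformIdeal (hπ : IsBlowup π C) {Y : Scheme.{u}}
    (i : Y ⟶ X) [IsClosedImmersion i] (hY : IsEffectiveCartier (C.comap i)) :
    ∃ e : (strictTransformIdeal π C i.ker).subscheme ≅ Y,
      e.hom ≫ i = (strictTransformIdeal π C i.ker).subschemeι ≫ π := by
  haveI := (isBlowup_lift_subschemeι_strictTransformIdeal hπ i).isIso hY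
  exact ⟨asIso (IsClosedImmersion.lift i ((strictTransformIdeal π C i.ker).subschemeι ≫ π)
    (ker_le_ker_subschemeι_strictTransformIdeal_comp π C i)), IsClosedImmersion.lift_fac _ _ _⟩

/-- **Clause (1) of Stacks Lemma 54.15.3 (Tag 0BI7)** in the binders of
`Stacks0BI7_intersectionMultiplicityDrop`: the strict transform `Y'` of the integral curve `Y` under
the blow-up of `X` in the closed point `p`, at which `𝒪_{Y,p}` is regular (a discrete valuation ring —
not a field because `p ∈ Z ∌ η_Y`), is `Y`: `Y' ≅ Y` over `X`. PROVED (chart-free: the pulled-back point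
is an effective Cartier divisor on `Y`, `isEffectiveCartier_comap_vanishingIdeal_singleton`, and the
strict transform is the blow-up of `Y` in it). [cite: StacksProject, Tag 0BI7 (Lemma 54.15.3 (1))] -/
theorem Stacks0BI7_clause1 (X Y : Scheme.{u}) [IsLocallyNoetherian X] [IsIntegral Y] (i : Y ⟶ X)
    [IsClosedImmersion i] (J : X.IdealSheafData) (p : X) (hp : IsClosed ({p} : Set X)) (y : Y)
    (hdim : topologicalKrullDim Y = 1) (hy : i y = p) (hreg : IsRegularLocalRing (Y.presheaf.stalk y))
    (hpZ : p ∈ J.support) (hη : i (genericPoint Y) ∉ J.support)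
    (X' : Scheme.{u}) (π : X' ⟶ X) (hπ : IsBlowup π (vanishingIdeal ⟨{p}, hp⟩)) :
    ∃ e : (strictTransformIdeal π (vanishingIdeal ⟨{p}, hp⟩) i.ker).subscheme ≅ Y,
      e.hom ≫ i = (strictTransformIdeal π (vanishingIdeal ⟨{p}, hp⟩) i.ker).subschemeι ≫ π := by
  haveI : IsLocallyNoetherian Y := LocallyOfFiniteType.isLocallyNoetherian i
  subst hy
  exact exists_iso_subscheme_strictTransformIdeal hπ i
    (isEffectiveCartier_comap_vanishingIdeal_singleton i y hp rfl hreg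
      (ringKrullDim_stalk_le_one hdim.le y) (maximalIdeal_stalk_ne_bot i J y hpZ hη))

end StrictTransform

/-! ## Clauses (2) and (3) of Lemma 54.15.3: the point `q` above `p` and the drop of the multiplicity

The printed proof computes in the chart `A[𝔪/x₁]` with the map `ψ : A[𝔪/x₁] → A/I` («Since the image of `x₁`
in `A[𝔪/x₁]` cuts out the exceptional divisor we conclude that `m_q(Y', E) = 1`»; «the ideal `J' ⊂ A[𝔪/x₁]`
certainly contains the elements `f/x₁` for `f ∈ J` … `ψ(f/x₁) = f̄/x₁` in `A/I` has valuation one less»). Here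
the same two facts are obtained chart-free, by transporting the lengths to the discrete valuation ring
`A = 𝒪_{Y,p} ≅ 𝒪_{Y',q}`: along a surjective ring map `θ : R → S` one has `ℓ_R(R ⧸ (ker θ + L)) = ℓ_S(S ⧸ θ(L))`
(Stacks Tag 00IX), applied to the stalk maps of the closed immersions `Y' ↪ X'`, `Y ↪ X` and to the isomorphism
`Y' ≅ Y` of clause (1). Clause (2): `𝓘(E)` restricts on `Y' ≅ Y` to `i^*𝓘_{p}`, whose stalk is `𝔪_{Y,p}`, and
`ℓ(A ⧸ 𝔪_A) = 1`. Clause (3): `π^*J = 𝓘(E) · (π^*J : 𝓘(E)) ⊆ 𝓘(E) · J'` (`J ⊆ 𝓘_{p}`) — the sheaf form of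
«`J'` contains the elements `f/x₁`» — so in `A` the image `J̄ ≠ 0` of `J` lies in `𝔪_A · J̄'`; by Nakayama
`J̄ ⊊ J̄'`, whence `ℓ(A ⧸ J̄') < ℓ(A ⧸ J̄) < ∞` («valuation one less», or more). -/

section Lengths

/-- **Lengths along a surjective ring map**: for `θ : R ↠ S` and an ideal `L ⊆ R`,
`ℓ_R(R ⧸ (ker θ + L)) = ℓ_S(S ⧸ θ(L))` (`R ⧸ (ker θ + L) ≅ S ⧸ θ(L)` and the `R`-submodules of the latter
are its `S`-submodules — Stacks, Algebra, Lemma 10.52.5: «If `R → S` is surjective then equality holds»).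
[cite: StacksProject, Tag 00IX (Algebra, Lemma 10.52.5)] -/
theorem length_quotient_ker_sup_eq_of_surjective {R S : Type*} [CommRing R] [CommRing S]
    (θ : R →+* S) (hθ : Function.Surjective θ) (L : Ideal R) :
    Module.length R (R ⧸ (RingHom.ker θ ⊔ L)) = Module.length S (S ⧸ L.map θ) := by
  let ψ : R →+* S ⧸ L.map θ := (Ideal.Quotient.mk (L.map θ)).comp θ
  have hψ : Function.Surjective ψ := Ideal.Quotient.mk_surjective.comp hθ
  have hkerψ : RingHom.ker ψ = RingHom.ker θ ⊔ L := by
    rw [← RingHom.comap_ker, Ideal.mk_ker, Ideal.comap_map_of_surjective θ hθ,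
      ← RingHom.ker_eq_comap_bot, sup_comm]
  letI : Algebra R (S ⧸ L.map θ) := ψ.toAlgebra
  have halg : algebraMap R (S ⧸ L.map θ) = ψ := rfl
  have hkerlin : LinearMap.ker (Algebra.linearMap R (S ⧸ L.map θ)) = RingHom.ker θ ⊔ L := by
    ext r
    rw [LinearMap.mem_ker, Algebra.linearMap_apply, halg, ← hkerψ, RingHom.mem_ker]
  have hsurj : Function.Surjective (Algebra.linearMap R (S ⧸ L.map θ)) := by
    intro b; obtain ⟨r, hr⟩ := hψ b; exact ⟨r, by rw [Algebra.linearMap_apply, halg, hr]⟩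
  let e : (R ⧸ (RingHom.ker θ ⊔ L)) ≃ₗ[R] (S ⧸ L.map θ) :=
    (Submodule.quotEquivOfEq _ _ (by rw [← hkerlin])).trans
      ((Algebra.linearMap R (S ⧸ L.map θ)).quotKerEquivOfSurjective hsurj)
  rw [e.length_eq, Module.length_eq_of_surjective (S := R) (R := S ⧸ L.map θ) (M := S ⧸ L.map θ)
      (halg ▸ hψ),
    ← Module.length_eq_of_surjective (S := S) (R := S ⧸ L.map θ) (M := S ⧸ L.map θ)
      Ideal.Quotient.mk_surjective]

/-- **The multiplicity module along a closed immersion**: for a closed immersion `τ : V ⟶ X`, an ideal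
sheaf `L` on `X` and `v ∈ V`, `ℓ_{𝒪_{X,τ v}}(𝒪_{X,τ v} ⧸ ((ker τ)_{τ v} + L_{τ v})) = ℓ_{𝒪_{V,v}}(𝒪_{V,v} ⧸ (τ^*L)_v)`
— Stacks, Algebra, Lemma 10.52.5 along the surjection `𝒪_{X,τ v} → 𝒪_{V,v}`, whose kernel is `(ker τ)_{τ v}`
(`stalkIdeal_ker_eq_ker_stalkMap`). [cite: StacksProject, Tag 00IX (Algebra, Lemma 10.52.5)] -/
theorem length_stalk_quotient_ker_sup_eq_comap {V X : Scheme.{u}} (τ : V ⟶ X) [IsClosedImmersion τ]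
    (L : X.IdealSheafData) (v : V) :
    Module.length (X.presheaf.stalk (τ v))
        (X.presheaf.stalk (τ v) ⧸ (stalkIdeal τ.ker (τ v) ⊔ stalkIdeal L (τ v))) =
      Module.length (V.presheaf.stalk v) (V.presheaf.stalk v ⧸ stalkIdeal (L.comap τ) v) := by
  rw [stalkIdeal_comap_eq_map_stalkMap, stalkIdeal_ker_eq_ker_stalkMap]
  exact length_quotient_ker_sup_eq_of_surjective _ (τ.stalkMap_surjective v) _

/-- The same for the closed subscheme `V(I) ↪ X` of an ideal sheaf `I` (Stacks, Algebra, Lemma 10.52.5 along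
`𝒪_{X,v} → 𝒪_{V(I),v}`). [cite: StacksProject, Tag 00IX (Algebra, Lemma 10.52.5)] -/
theorem length_stalk_quotient_sup_eq_subscheme {X : Scheme.{u}} (I L : X.IdealSheafData)
    (v : I.subscheme) :
    Module.length (X.presheaf.stalk (I.subschemeι v))
        (X.presheaf.stalk (I.subschemeι v) ⧸
          (stalkIdeal I (I.subschemeι v) ⊔ stalkIdeal L (I.subschemeι v))) =
      Module.length (I.subscheme.presheaf.stalk v)
        (I.subscheme.presheaf.stalk v ⧸ stalkIdeal (L.comap I.subschemeι) v) := by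
  have h := length_stalk_quotient_ker_sup_eq_comap I.subschemeι L v
  rwa [ker_subschemeι] at h

/-- **Lengths are invariant along an isomorphism** `f : V ⟶ Y`:
`ℓ_{𝒪_{V,v}}(𝒪_{V,v} ⧸ (f^*M)_v) = ℓ_{𝒪_{Y,f v}}(𝒪_{Y,f v} ⧸ M_{f v})` (Stacks, Algebra, Lemma 10.52.5 along the
bijective stalk map; the kernel ideal sheaf of an isomorphism is `0`).
[cite: StacksProject, Tag 00IX (Algebra, Lemma 10.52.5)] -/
theorem length_stalk_quotient_comap_eq_of_isIso {V Y : Scheme.{u}} (f : V ⟶ Y) [IsIso f]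
    (M : Y.IdealSheafData) (v : V) :
    Module.length (V.presheaf.stalk v) (V.presheaf.stalk v ⧸ stalkIdeal (M.comap f) v) =
      Module.length (Y.presheaf.stalk (f v)) (Y.presheaf.stalk (f v) ⧸ stalkIdeal M (f v)) := by
  rw [← length_stalk_quotient_ker_sup_eq_comap f M v, Scheme.Hom.ker_eq_bot_of_isIso, stalkIdeal_bot,
    bot_sup_eq]

/-- `ℓ_A(A ⧸ 𝔪_A) = 1` for a local ring `A` (Stacks, Algebra, Lemma 10.52.6: with `𝔪M = 0` the length is the
dimension over `A/𝔪`). [cite: StacksProject, Tag 00IY (Algebra, Lemma 10.52.6)] -/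
theorem length_quotient_maximalIdeal {A : Type*} [CommRing A] [IsLocalRing A] :
    Module.length A (A ⧸ maximalIdeal A) = 1 :=
  Module.length_eq_one_iff.mpr
    (isSimpleModule_iff_isCoatom.mpr (Ideal.isMaximal_def.mp (maximalIdeal.isMaximal A)))

/-- **Nakayama form of the multiplicity drop**: in a Noetherian local ring `A`, if `0 ≠ I ⊆ 𝔪 · N` and
`ℓ(A ⧸ I) < ∞` then `ℓ(A ⧸ N) < ℓ(A ⧸ I)` (`I ⊊ N` since `N = 𝔪 N` forces `N = 0` by Nakayama's lemma,
Stacks Algebra, Lemma 10.20.1, and lengths of quotients are strictly antitone on ideals of finite colength). The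
abstract form of the last step («has valuation one less») of the proof of Stacks Tag 0BI7.
[cite: StacksProject, Tag 00DV (Algebra, Lemma 10.20.1)] -/
theorem length_quotient_lt_of_le_maximalIdeal_mul {A : Type*} [CommRing A] [IsLocalRing A]
    [IsNoetherianRing A] {I N : Ideal A} (hI0 : I ≠ ⊥) (hIN : I ≤ maximalIdeal A * N)
    (hfin : Module.length A (A ⧸ I) ≠ ⊤) :
    Module.length A (A ⧸ N) < Module.length A (A ⧸ I) := by
  have hIN' : I ≤ N := hIN.trans Ideal.mul_le_left
  have hlt : I < N := by
    refine lt_of_le_of_ne hIN' fun h => hI0 ?_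
    rw [← h] at hIN
    exact Submodule.eq_bot_of_le_smul_of_le_jacobson_bot (maximalIdeal A) I (IsNoetherian.noetherian I)
      hIN (IsLocalRing.maximalIdeal_le_jacobson ⊥)
  rw [Module.length_quotient] at hfin ⊢
  rw [Module.length_quotient]
  exact Order.coheight_strictAnti hlt
    (lt_of_le_of_lt (Order.coheight_anti hIN') (lt_top_iff_ne_top.mpr hfin))

end Lengths

section PointAbove

variable {X Y X' : Scheme.{u}} [IsLocallyNoetherian X] [IsIntegral Y] (i : Y ⟶ X) [IsClosedImmersion i]
  (J C : X.IdealSheafData) (y : Y) {π : X' ⟶ X}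

/-- **Clauses (2) and (3) of Stacks Lemma 54.15.3 (Tag 0BI7), core form.** For a blow-up `π : X' ⟶ X`
(`X` locally Noetherian) with centre `V(C)`, a closed immersion `i : Y ⟶ X` of an integral curve `Y`
(`dim Y = 1`) and a point `y` with `𝒪_{Y,y}` regular, such that `i^*C` is an effective Cartier divisor on
`Y` with stalk `𝔪_{Y,y}` at `y`, and an ideal sheaf `J ⊆ C` with `i y ∈ V(J) ∌ i(η_Y)`: there is a unique
point `q` of the strict transform `Y' = V(σᶜ(i.ker))` above `i y`; `ℓ_{𝒪_{X',q}}(𝒪_{X',q} ⧸ (σᶜ(i.ker)_q +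
𝓘(E)_q)) = 1`; and `ℓ_{𝒪_{X',q}}(𝒪_{X',q} ⧸ (σᶜ(i.ker)_q + σᶜ(J)_q)) < ℓ_{𝒪_{X,i y}}(𝒪_{X,i y} ⧸ ((i.ker)_{i y} +
J_{i y}))` (unconditionally — in particular when `q ∈ V(σᶜ(J))`, as printed).
[cite: StacksProject, Tag 0BI7 (Lemma 54.15.3 (2), (3))] -/
theorem Stacks0BI7_core (hdim : topologicalKrullDim Y = 1)
    (hreg : IsRegularLocalRing (Y.presheaf.stalk y)) (hη : i (genericPoint Y) ∉ J.support)
    (hJC : J ≤ C) (hCY : IsEffectiveCartier (C.comap i))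
    (hCy : stalkIdeal (C.comap i) y = maximalIdeal (Y.presheaf.stalk y)) (hπ : IsBlowup π C) :
    ∃ q : X',
      ((strictTransformIdeal π C i.ker).support : Set X') ∩ π ⁻¹' {i y} = {q} ∧
      Module.length (X'.presheaf.stalk q) (X'.presheaf.stalk q ⧸
        (stalkIdeal (strictTransformIdeal π C i.ker) q ⊔ stalkIdeal (C.comap π) q)) = 1 ∧
      Module.length (X'.presheaf.stalk q) (X'.presheaf.stalk q ⧸
          (stalkIdeal (strictTransformIdeal π C i.ker) q ⊔ stalkIdeal (strictTransformIdeal π C J) q)) <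
        Module.length (X.presheaf.stalk (i y))
          (X.presheaf.stalk (i y) ⧸ (stalkIdeal i.ker (i y) ⊔ stalkIdeal J (i y))) := by
  haveI : IsLocallyNoetherian Y := LocallyOfFiniteType.isLocallyNoetherian i
  obtain ⟨e, he⟩ := exists_iso_subscheme_strictTransformIdeal hπ i hCY
  obtain ⟨v, rfl⟩ : ∃ v, e.hom v = y :=
    ⟨e.inv y, by rw [← Scheme.Hom.comp_apply, Iso.inv_hom_id]; rfl⟩
  -- `q := ι' v` lies above `i (e.hom v)`
  have hq : π ((strictTransformIdeal π C i.ker).subschemeι v) = i (e.hom v) := by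
    rw [← Scheme.Hom.comp_apply, ← he, Scheme.Hom.comp_apply]
  -- the exceptional divisor and `J` seen on `Y' ≅ Y`
  have hE : (C.comap π).comap (strictTransformIdeal π C i.ker).subschemeι = (C.comap i).comap e.hom := by
    rw [← comap_comp, ← he, comap_comp]
  refine ⟨(strictTransformIdeal π C i.ker).subschemeι v, ?_, ?_, ?_⟩
  · -- (2a) `Y' ∩ π⁻¹{p} = {q}`
    ext q'
    simp only [Set.mem_inter_iff, Set.mem_preimage, Set.mem_singleton_iff]
    constructor
    · rintro ⟨hq'1, hq'2⟩
      rw [← range_subschemeι] at hq'1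
      obtain ⟨v', rfl⟩ := hq'1
      have h1 : i (e.hom v') = i (e.hom v) := by
        rw [← Scheme.Hom.comp_apply, he, Scheme.Hom.comp_apply, hq'2]
      rw [e.hom.isClosedEmbedding.injective (i.isClosedEmbedding.injective h1)]
    · rintro rfl
      refine ⟨?_, hq⟩
      rw [← range_subschemeι]
      exact ⟨v, rfl⟩
  · -- (2b) `ℓ(𝒪_{X',q} ⧸ (σᶜ(i.ker)_q + 𝓘(E)_q)) = ℓ(𝒪_{Y,y} ⧸ 𝔪) = 1`
    rw [length_stalk_quotient_sup_eq_subscheme, hE, length_stalk_quotient_comap_eq_of_isIso e.hom, hCy]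
    exact length_quotient_maximalIdeal
  · -- (3) transport both sides to `A = 𝒪_{Y, e.hom v}`
    rw [length_stalk_quotient_sup_eq_subscheme, length_stalk_quotient_ker_sup_eq_comap i J (e.hom v)]
    have hJ' : (strictTransformIdeal π C J).comap (strictTransformIdeal π C i.ker).subschemeι =
        (((strictTransformIdeal π C J).comap (strictTransformIdeal π C i.ker).subschemeι).comap
          e.inv).comap e.hom := by
      rw [← comap_comp, Iso.hom_inv_id, comap_id]
    rw [hJ', length_stalk_quotient_comap_eq_of_isIso e.hom]
    -- `J̄ ⊆ 𝔪_A · J̄'` from `π^*J = 𝓘(E) · (π^*J : 𝓘(E)) ⊆ 𝓘(E) · σᶜ(J)`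
    have h1 : J.comap π ≤ C.comap π * strictTransformIdeal π C J := by
      have hle : J.comap π ≤ C.comap π ^ 1 := by rw [pow_one]; exact comap_mono _ hJC
      have hct := controlledTransform_le_strictTransformIdeal π C J 1
      rw [controlledTransform] at hct
      calc J.comap π = C.comap π ^ 1 * colon (J.comap π) (C.comap π ^ 1) :=
          (pow_mul_colon_eq_of_le_of_isEffectiveCartier hπ.isEffectiveCartier hle).symm
        _ ≤ C.comap π ^ 1 * strictTransformIdeal π C J := mul_le_mul' le_rfl hct
        _ = C.comap π * strictTransformIdeal π C J := by rw [pow_one]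
    have h2 : J.comap i =
        ((J.comap π).comap (strictTransformIdeal π C i.ker).subschemeι).comap e.inv := by
      rw [← comap_comp, ← comap_comp, Category.assoc, ← he, Iso.inv_hom_id_assoc]
    have h3 : C.comap i =
        ((C.comap π).comap (strictTransformIdeal π C i.ker).subschemeι).comap e.inv := by
      rw [← comap_comp, ← comap_comp, Category.assoc, ← he, Iso.inv_hom_id_assoc]
    have hincl : stalkIdeal (J.comap i) (e.hom v) ≤ maximalIdeal _ *
        stalkIdeal ((((strictTransformIdeal π C J).comap
          (strictTransformIdeal π C i.ker).subschemeι).comap e.inv)) (e.hom v) := by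
      rw [← hCy, ← stalkIdeal_mul]
      apply stalkIdeal_mono
      rw [h2, h3, ← comap_mul, ← comap_mul]
      exact comap_mono _ (comap_mono _ h1)
    -- finiteness of `m_p` (Tag 0BI3) and `J̄ ≠ 0`
    have hfin : Module.length (Y.presheaf.stalk (e.hom v))
        (Y.presheaf.stalk (e.hom v) ⧸ stalkIdeal (J.comap i) (e.hom v)) ≠ ⊤ := by
      rw [← length_stalk_quotient_ker_sup_eq_comap i J (e.hom v)]
      exact length_stalk_quotient_ker_sup_ne_top i J (e.hom v) hdim hreg hη
    have hJ0 : stalkIdeal (J.comap i) (e.hom v) ≠ ⊥ := by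
      rw [stalkIdeal_comap_eq_map_stalkMap]
      exact map_stalkMap_stalkIdeal_ne_bot i J (e.hom v) hη
    exact length_quotient_lt_of_le_maximalIdeal_mul hJ0 hincl hfin

/-- **Stacks Lemma 54.15.3 (Tag 0BI7), PROVED** — the statement of the named fact
`Stacks0BI7_intersectionMultiplicityDrop` (`PointBlowupIntersectionMultiplicity.lean`), verbatim, as a
theorem: clause (1) by `Stacks0BI7_clause1` (the strict transform of `Y` is the blow-up of `Y` in the
effective Cartier divisor `p`, an isomorphism), clauses (2) and (3) by `Stacks0BI7_core` with `C = 𝓘_{p}`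
(`J ⊆ 𝓘_{p}` because `p ∈ V(J)`; `(i^*𝓘_{p})_y = 𝔪_{Y,y}`). AI-formalized from the printed proof; the drop
(3) holds even without the printed hypothesis `q ∈ Z'`. [cite: StacksProject, Tag 0BI7 (Lemma 54.15.3)] -/
theorem Stacks0BI7_intersectionMultiplicityDrop_proof :
    ∀ (X Y : Scheme.{u}) [IsLocallyNoetherian X] [IsIntegral Y] (i : Y ⟶ X) [IsClosedImmersion i]
      (J : X.IdealSheafData) (p : X) (hp : IsClosed ({p} : Set X)) (y : Y),
      topologicalKrullDim Y = 1 → i y = p → IsRegularLocalRing (Y.presheaf.stalk y) →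
      p ∈ J.support → i (genericPoint Y) ∉ J.support →
      ∀ (X' : Scheme.{u}) (π : X' ⟶ X), IsBlowup π (vanishingIdeal ⟨{p}, hp⟩) →
        (∃ e : (strictTransformIdeal π (vanishingIdeal ⟨{p}, hp⟩) i.ker).subscheme ≅ Y,
            e.hom ≫ i = (strictTransformIdeal π (vanishingIdeal ⟨{p}, hp⟩) i.ker).subschemeι ≫ π) ∧
        ∃ q : X',
          ((strictTransformIdeal π (vanishingIdeal ⟨{p}, hp⟩) i.ker).support : Set X') ∩ π ⁻¹' {p} = {q} ∧
          Module.length (X'.presheaf.stalk q) (X'.presheaf.stalk q ⧸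
            (stalkIdeal (strictTransformIdeal π (vanishingIdeal ⟨{p}, hp⟩) i.ker) q ⊔
              stalkIdeal ((vanishingIdeal ⟨{p}, hp⟩).comap π) q)) = 1 ∧
          (q ∈ (strictTransformIdeal π (vanishingIdeal ⟨{p}, hp⟩) J).support →
            Module.length (X'.presheaf.stalk q) (X'.presheaf.stalk q ⧸
                (stalkIdeal (strictTransformIdeal π (vanishingIdeal ⟨{p}, hp⟩) i.ker) q ⊔
                  stalkIdeal (strictTransformIdeal π (vanishingIdeal ⟨{p}, hp⟩) J) q)) <
              Module.length (X.presheaf.stalk p)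
                (X.presheaf.stalk p ⧸ (stalkIdeal i.ker p ⊔ stalkIdeal J p))) := by
  intro X Y _ _ i _ J p hp y hdim hy hreg hpZ hη X' π hπ
  refine ⟨Stacks0BI7_clause1 X Y i J p hp y hdim hy hreg hpZ hη X' π hπ, ?_⟩
  subst hy
  haveI : IsLocallyNoetherian Y := LocallyOfFiniteType.isLocallyNoetherian i
  have hJC : J ≤ vanishingIdeal ⟨{i y}, hp⟩ :=
    le_support_iff_le_vanishingIdeal.mp (fun x hx => by
      obtain rfl : x = i y := hx
      exact hpZ)
  have hCY : IsEffectiveCartier ((vanishingIdeal ⟨{i y}, hp⟩).comap i) :=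
    isEffectiveCartier_comap_vanishingIdeal_singleton i y hp rfl hreg
      (ringKrullDim_stalk_le_one hdim.le y) (maximalIdeal_stalk_ne_bot i J y hpZ hη)
  have hCy : stalkIdeal ((vanishingIdeal ⟨{i y}, hp⟩).comap i) y = maximalIdeal (Y.presheaf.stalk y) := by
    rw [stalkIdeal_comap_eq_map_stalkMap, stalkIdeal_vanishingIdeal_singleton hp,
      map_stalkMap_maximalIdeal_eq i y (i.stalkMap_surjective y)]
  obtain ⟨q, h1, h2, h3⟩ := Stacks0BI7_core i J _ y hdim hreg hη hJC hCY hCy hπ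
  exact ⟨q, h1, h2, fun _ => h3⟩

end PointAbove

end Literature.AlgebraicGeometry.Resolution

end
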